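import Summits.QuantumAdvantage.QuantumAdvantage.Theorems.CubicForrelationNearExactIsExactCubicFormCellL6
import Summits.QuantumAdvantage.QuantumAdvantage.Theorems.CubicForrelationNearExactIsExactCubicFormBalanced
import Summits.QuantumAdvantage.QuantumAdvantage.Theorems.CubicForrelationNearExactIsExactCubicFormCellsOne

/-!
# Crux `CubicForrelation.NearExactIsExact` (stmt-QuantumAdvantage-14043) — E1280-even, R4 branch: EXACT CELLS are periodic along the
  radical of `ω_{2h}` (descendants `x₁q₄` = `HL 2` and `T` = `HL 1`)

Certificate seat `b2b-cforr-cert` (gen 43).  HONEST FRAMING: kernel-checked lemma (standard axioms) for the descendants of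
…CubicFormR4PartnerDispatch.  R4-PARTNER.md §5–6 / E1280-HANDPROOFS §2 argue through the menus (MT)/(MQ) and a shear; the Lean route is
shorter: an exact cell (`32 − 2^{5−h}` ones, cubic form `s₀ ∧ ω_{2h}`) does not depend on the coordinates off the support of `ω`
(`tq4_cell_period`): by …CubicFormCellL6 one `s₀`-half vanishes, the other is a quadratic with form `ω` (…CubicFormCellL2), and a radical
direction along which it is not periodic would make it balanced (`tcb_balanced_iff`), i.e. of weight `32`.  So all difference data of
`κ` in those `z`-directions vanish on the exact cells.  The finite facts about `Z₁₀` are in …CubicFormR4QfPolar.  Nothing about `θ₁₂`;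
NOT summit progress.

References: this seat lineage (g37 R4-PARTNER §5–6, g39 HANDPROOFS §2); L. E. Dickson (1901).  Axioms: the standard three.
-/

set_option linter.dupNamespace false -- D-0017: single-problem summit ⇒ `QuantumAdvantage.QuantumAdvantage` by design

namespace Summit.QuantumAdvantage.QuantumAdvantage.Theorems.CubicForrelation.NearExactIsExact

open Finset
open Literature.Computability.QuantumComplexity
open Literature.Computability.QuantumComplexity.BuzetChailloux (bxor zeroVec bxor_comm bxor_self bxor_zeroVec zeroVec_bxor
  bxor_bxor_cancel_left)


/-- **Exact cells are periodic off the support of `ω`.**  Let `f : 𝔽₂^{1+6} → 𝔽₂` have third differences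
`u₀·ω(v,w) ⊕ v₀·ω(u,w) ⊕ w₀·ω(u,v)` with `ω = Σ_{i<h} s_{lo i} ∧ s_{hi i}` and fewer than `32` ones, and let `m` be a coordinate outside the
images of `lo, hi`.  Then `f(y ⊕ e_{1+m}) = f(y)` for all `y`.  (By `tl6_cell_light` one half vanishes; the other is a quadratic whose form is
`ω`, and `e_m` lies in its radical; were it not a period, the half would be balanced (`tcb_balanced_iff`), of weight `32`.) [this work] -/
theorem tq4_cell_period (f : (Fin (1 + 6) → Bool) → Bool) (h : ℕ) (hh1 : 1 ≤ h) (hh5 : h ≤ 5) (lo hi : Fin h → Fin 6)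
    (hlo : Function.Injective lo) (hhi : Function.Injective hi) (hlohi : ∀ i j, lo i ≠ hi j)
    (ω' : (Fin 6 → Bool) → (Fin 6 → Bool) → Bool)
    (hω' : ∀ v w, ω' v w = decide ((∑ i : Fin h, ((if v (lo i) = true then (1 : ZMod 2) else 0) * (if w (hi i) = true then (1 : ZMod 2) else 0) +
        (if v (hi i) = true then (1 : ZMod 2) else 0) * (if w (lo i) = true then (1 : ZMod 2) else 0))) = 1))
    (hT : ∀ u v w x : Fin (1 + 6) → Bool,
      (((f x ^^ f (bxor x w)) ^^ (f (bxor x v) ^^ f (bxor (bxor x v) w))) ^^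
          ((f (bxor x u) ^^ f (bxor (bxor x u) w)) ^^ (f (bxor (bxor x u) v) ^^ f (bxor (bxor (bxor x u) v) w)))) =
        (((u (Fin.castAdd 6 (0 : Fin 1)) && ω' (fun j => v (Fin.natAdd 1 j)) (fun j => w (Fin.natAdd 1 j))) ^^
            (v (Fin.castAdd 6 (0 : Fin 1)) && ω' (fun j => u (Fin.natAdd 1 j)) (fun j => w (Fin.natAdd 1 j)))) ^^
          (w (Fin.castAdd 6 (0 : Fin 1)) && ω' (fun j => u (Fin.natAdd 1 j)) (fun j => v (Fin.natAdd 1 j)))))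
    (hlt : #(univ.filter fun y : Fin (1 + 6) → Bool => f y = true) < 32)
    (m : Fin 6) (hml : ∀ i, lo i ≠ m) (hmh : ∀ i, hi i ≠ m) :
    ∀ y : Fin (1 + 6) → Bool, f (bxor y (fun l => decide (l = Fin.natAdd 1 m))) = f y := by
  obtain ⟨h3, hforms⟩ := tl2_cell_halves f ω' hT
  obtain ⟨-, hex⟩ := tl6_cell_light f h hh1 hh5 lo hi hlo hhi hlohi ω' hω' hT
  obtain ⟨-, hhalf⟩ := hex hlt
  have hcard := tco_card_halves f
  -- `e_m` is `ω'`-orthogonal to everything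
  have hωm : ∀ w, ω' (fun l => decide (l = m)) w = false := by
    intro w
    rw [hω']
    have h0 : ∀ i, decide (lo i = m) = false := fun i => decide_eq_false (hml i)
    have h1 : ∀ i, decide (hi i = m) = false := fun i => decide_eq_false (hmh i)
    simp only [h0, h1, Bool.false_eq_true, if_false, zero_mul, zero_add, sum_const_zero]
    decide
  -- each half is `e_m`-periodic
  have hper : ∀ b : Bool, ∀ s : Fin 6 → Bool,
      f (Fin.append ![b] (bxor s (fun l => decide (l = m)))) = f (Fin.append ![b] s) := by
    intro b
    -- the half `g = f(b, ·)` and its base-point free form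
    have h3b := h3 b
    simp only at h3b
    set g : (Fin 6 → Bool) → Bool := fun s => f (Fin.append ![b] s) with hg
    obtain ⟨B, hB⟩ : ∃ B : (Fin 6 → Bool) → (Fin 6 → Bool) → Bool,
        ∀ v w, B v w = ((g zeroVec ^^ g (bxor zeroVec w)) ^^ (g (bxor zeroVec v) ^^ g (bxor (bxor zeroVec v) w))) :=
      ⟨_, fun v w => rfl⟩
    have hB' : ∀ v w x, ((g x ^^ g (bxor x w)) ^^ (g (bxor x v) ^^ g (bxor (bxor x v) w))) = B v w :=
      fun v w x => by rw [hB]; exact tl2_second_const g h3b v w x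
    obtain ⟨hsymm, -, -, htr⟩ := tcb_form_basic g B hB'
    -- either this half vanishes (trivial) or the other one does (then `B = ω'`)
    by_cases hzero : ∀ s, g s = false
    · intro s
      have e1 := hzero (bxor s (fun l => decide (l = m)))
      have e2 := hzero s
      simp only [hg] at e1 e2
      rw [e1, e2]
    · -- the other half vanishes
      have hother : ∀ s, f (Fin.append ![!b] s) = false := by
        rcases hhalf with h0 | h1
        · cases b
          · exact absurd h0 hzero
          · exact h0
        · cases b
          · exact h1
          · exact absurd h1 hzero
      have hBω : ∀ v w, B v w = ω' v w := by
        intro v w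
        rw [← hforms v w zeroVec zeroVec]
        cases b
        · have hz : ∀ s, f (Fin.append ![true] s) = false := hother
          simp only [hz, Bool.xor_false]
          rw [hB]
        · have hz : ∀ s, f (Fin.append ![false] s) = false := hother
          simp only [hz, Bool.xor_false, Bool.false_xor]
          rw [hB]
      -- weight of this half is `< 32`, so it is not balanced, so `e_m` (in the radical) is a period
      have hcard_b : #(univ.filter fun x : Fin 6 → Bool => g x = true) < 32 := by
        have hz : #(univ.filter fun x : Fin 6 → Bool => f (Fin.append ![!b] x) = true) = 0 := by
          rw [card_eq_zero, filter_eq_empty_iff]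
          intro s _ hs
          rw [hother s] at hs
          exact Bool.false_ne_true hs
        cases b
        · simp only [Bool.not_false] at hz; simp only [hg]; omega
        · simp only [Bool.not_true] at hz; simp only [hg]; omega
      have hrad : ∀ y, B (fun l => decide (l = m)) y = false := fun y => by rw [hBω]; exact hωm y
      have hval : g (fun l => decide (l = m)) = g zeroVec := by
        by_contra hne
        have hbal := (tcb_balanced_iff g B hB').mpr ⟨_, hrad, hne⟩
        norm_num at hbal
        omega
      intro s
      have e := htr s (fun l => decide (l = m))
      rw [hsymm] at e
      rw [hrad s, hval, Bool.xor_self, Bool.xor_false, Bool.xor_false] at e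
      exact e
  -- glue the halves
  intro y
  have hy : y = Fin.append ![y (Fin.castAdd 6 (0 : Fin 1))] (fun j => y (Fin.natAdd 1 j)) := by
    funext l
    refine Fin.addCases (fun i => ?_) (fun j => ?_) l
    · rw [Fin.append_left]
      have : i = 0 := Fin.eq_zero i
      subst this; rfl
    · rw [Fin.append_right]
  rw [hy, tco_unit_right, tco_append_bxor, bxor_zeroVec]
  exact hper _ _

end Summit.QuantumAdvantage.QuantumAdvantage.Theorems.CubicForrelation.NearExactIsExact
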